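import Literature.NumberTheory.EllipticCurves.HidaOrdinaryCohomologyCocycles
import Mathlib.LinearAlgebra.Projectivization.Basic
import HarnessLib

/-!
# Modular symbols `Symb_Γ(V) = Hom_Γ(Δ₀, V)` with coefficients in a right module, and their Hecke
# operators

The overconvergent / `Λ`-adic modular symbols of Stevens, Pollack–Stevens, Greenberg–Stevens and
Bellaïche are `Γ`-invariant additive functions on the degree-zero divisors `Δ₀` of `ℙ¹(ℚ)` with
values in a coefficient module carrying a RIGHT action of a semigroup of integer matrices
(`Symb_Γ(V) := Hom_Γ(Δ₀, V)`, `(Φ|g)(D) = Φ(gD)|g`; Bellaïche 2011, §3.2.1; Pollack–Stevens 2011,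
§2).  The tree has modular symbols only through Manin-symbol presentations (`ManinSymbolsWeightK`)
and the weight-`2` periods `{∞, r}_f` (`ModularSymbols`); this file sets up the abstract object:

* `P1Q = ℙ(ℚ²)`, the cusps `∞ = [1:0]`, `r = [r:1]` and the **projective action** `P1Q.act g` of an
  integer matrix of non-zero determinant (Mathlib `Projectivization.map` of `toLin' g`; no case
  analysis), a left action (`act_mul`, `act_one`);
* `modSym R V ⊆ (P1Q → P1Q → V)`, the functions `φ(x, y)` ("`Φ({y} − {x})`") with
  `φ(x,y) + φ(y,z) = φ(x,z)` — canonically `Hom(Δ₀, V)`;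
* a **coefficient system on a set `S` of matrices** (`CoeffActionOn S R V`: `R`-linear right
  action `ρ`, `ρ(MM') = ρ(M') ∘ ρ(M)` for `M, M' ∈ S`, `ρ(1) = id`) — e.g. `Symⁿ` on all matrices
  (`HidaOrdinaryCohomologyCocycles.act`), or the weight-`k` distributions `𝔻(ℤ_p)` on `Σ₀(p)`;
* the **slash action** `slash A g φ (x, y) = ρ(g) (φ(g x, g y))` on functions, a right action
  for `g ∈ S` of non-zero determinant (`slash_mul`, `slash_one`), preserving `modSym`;
* `Symb A Γ`, the `Γ`-invariant elements of `modSym` (`Γ ≤ SL(2, ℤ)`);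
* the **Hecke operator** `hecke A N p φ = Σᵢ φ | βᵢ` over the representatives
  `βᵢ = heckeRep p i` of `Γ₀(N) diag(1,p) Γ₀(N)` (`HeckeOperatorsGamma0Proofs`), which preserves
  `Symb A (Γ₀(N))` when `Γ₀(N)` and the `βᵢ` lie in `S`
  (`hecke_mem_Symb`; the proof is Shimura's: `βᵢ γ = γ'ᵢ β_{σ(i)}`, `heckePermElt_spec`, and `σ` is a
  bijection, `heckePermEquiv`);
* morphisms of coefficient systems induce maps `Symb A Γ → Symb B Γ` commuting with `hecke`
  (`Hom.mapFun_mem_Symb`, `Hom.mapFun_hecke`) — the shape of every "specialisation" map.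

Brick B3c of the bottom-up plan recorded with the named fact
`greenbergStevens_kitagawa_twoVariable_interpolation_allBranches` (B3 follows Bellaïche 2011 §3–4).
Everything is proved; no named facts.

## References

* J. Bellaïche, *Critical `p`-adic `L`-functions*, Invent. Math. 189 (2012), §3.2.1. [Bellaiche2011]
* R. Pollack, G. Stevens, Ann. Sci. ÉNS 44 (2011), §2. [PollackStevens2011]
* G. Shimura, *Introduction to the arithmetic theory of automorphic functions* (1971), §3.4, §8.3. [Shimura1971]
-/

noncomputable section

open scoped MatrixGroups
open CongruenceSubgroup Matrix

namespace Literature.NumberTheory.EllipticCurves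

open ModularForms ModularForms.HidaCohomology

/-! ### `ℙ¹(ℚ)` and the projective action of integer matrices -/

/-- **`ℙ¹(ℚ)`** as the projectivisation of `ℚ²`. [folklore] -/
abbrev P1Q : Type := Projectivization ℚ (Fin 2 → ℚ)

namespace P1Q

/-- The cusp `∞ = [1 : 0]`. [folklore] -/
def infty : P1Q := Projectivization.mk ℚ ![1, 0] (by simp)

/-- The cusp `r = [r : 1]` of a rational number. [folklore] -/
def ofRat (r : ℚ) : P1Q := Projectivization.mk ℚ ![r, 1] (by simp)

/-- The rational matrix of an integer matrix. [folklore] -/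
abbrev ratMat (g : Matrix (Fin 2) (Fin 2) ℤ) : Matrix (Fin 2) (Fin 2) ℚ := g.map (Int.castRingHom ℚ)

/-- `det (ratMat g) = det g`. [folklore] -/
theorem det_ratMat (g : Matrix (Fin 2) (Fin 2) ℤ) : (ratMat g).det = (g.det : ℚ) := by
  rw [show ratMat g = (Int.castRingHom ℚ).mapMatrix g from rfl, ← RingHom.map_det]
  rfl

/-- A rational matrix of non-zero determinant acts injectively on `ℚ²`. [folklore] -/
theorem toLin'_injective_of_det_ne_zero {A : Matrix (Fin 2) (Fin 2) ℚ} (h : A.det ≠ 0) :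
    Function.Injective (Matrix.toLin' A) := by
  have hA : IsUnit A := (Matrix.isUnit_iff_isUnit_det A).mpr (isUnit_iff_ne_zero.mpr h)
  have hinj := Matrix.mulVec_injective_iff_isUnit.mpr hA
  intro v w hvw
  rw [Matrix.toLin'_apply, Matrix.toLin'_apply] at hvw
  exact hinj hvw

/-- Congruence for `Projectivization.map` in its (proof-carrying) function argument. [folklore] -/
theorem map_congr {f g : (Fin 2 → ℚ) →ₗ[ℚ] (Fin 2 → ℚ)} (h : f = g) (hf : Function.Injective f)
    (hg : Function.Injective g) :
    Projectivization.map f hf = Projectivization.map g hg := by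
  subst h; rfl

/-- **The projective (Möbius) action of an integer matrix on `ℙ¹(ℚ)`** (`[v] ↦ [g v]`), for `g` of
non-zero determinant; the junk value `id` for singular `g`. [folklore] -/
def act (g : Matrix (Fin 2) (Fin 2) ℤ) : P1Q → P1Q :=
  if h : (ratMat g).det ≠ 0 then Projectivization.map (Matrix.toLin' (ratMat g)) (toLin'_injective_of_det_ne_zero h)
  else id

/-- Unfolding `act` for `det g ≠ 0`. [folklore] -/
theorem act_eq (g : Matrix (Fin 2) (Fin 2) ℤ) (h : (ratMat g).det ≠ 0) :
    act g = Projectivization.map (Matrix.toLin' (ratMat g)) (toLin'_injective_of_det_ne_zero h) := by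
  rw [act, dif_pos h]

/-- `det g ≠ 0` in `ℚ` from `det g ≠ 0` in `ℤ`. [folklore] -/
theorem det_ratMat_ne_zero {g : Matrix (Fin 2) (Fin 2) ℤ} (h : g.det ≠ 0) : (ratMat g).det ≠ 0 := by
  rw [det_ratMat]; exact_mod_cast h

/-- **`act` is a left action** on matrices of non-zero determinant: `act (g g') = act g ∘ act g'`.
[folklore] -/
theorem act_mul {g g' : Matrix (Fin 2) (Fin 2) ℤ} (hg : g.det ≠ 0) (hg' : g'.det ≠ 0) :
    act (g * g') = act g ∘ act g' := by
  have hgg' : (g * g').det ≠ 0 := by rw [Matrix.det_mul]; exact mul_ne_zero hg hg'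
  rw [act_eq _ (det_ratMat_ne_zero hgg'), act_eq _ (det_ratMat_ne_zero hg), act_eq _ (det_ratMat_ne_zero hg'),
    ← Projectivization.map_comp]
  apply map_congr
  rw [← Matrix.toLin'_mul, ratMat, Matrix.map_mul]

/-- The identity acts trivially. [folklore] -/
theorem act_one : act (1 : Matrix (Fin 2) (Fin 2) ℤ) = id := by
  have h1 : (ratMat 1).det ≠ 0 := by rw [det_ratMat, Matrix.det_one, Int.cast_one]; exact one_ne_zero
  rw [act_eq _ h1, ← Projectivization.map_id]
  apply map_congr
  rw [ratMat, Matrix.map_one _ (map_zero _) (map_one _), Matrix.toLin'_one]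

/-- `act g (act g' x) = act (g g') x`. [folklore] -/
theorem act_act {g g' : Matrix (Fin 2) (Fin 2) ℤ} (hg : g.det ≠ 0) (hg' : g'.det ≠ 0) (x : P1Q) :
    act g (act g' x) = act (g * g') x := by
  rw [act_mul hg hg']; rfl

end P1Q

/-! ### Additive functions on pairs of cusps: `Hom(Δ₀, V)` -/

section ModSym

variable (R V : Type*) [CommRing R] [AddCommGroup V] [Module R V]

/-- **`Hom(Δ₀, V)` as additive functions on pairs of cusps**: `φ(x, y)` is the value on the divisor
`{y} − {x}`, additivity is `φ(x,y) + φ(y,z) = φ(x,z)`. [cite: Bellaiche2011, §3.2.1] -/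
def modSym : Submodule R (P1Q → P1Q → V) where
  carrier := {φ | ∀ x y z : P1Q, φ x y + φ y z = φ x z}
  add_mem' := by
    intro φ ψ hφ hψ x y z
    simp only [Pi.add_apply]
    rw [add_add_add_comm, hφ, hψ]
  zero_mem' := fun x y z => by simp
  smul_mem' := by
    intro c φ hφ x y z
    simp only [Pi.smul_apply, ← smul_add]
    rw [hφ]

variable {R V}

/-- Membership in `modSym`. [folklore] -/
theorem mem_modSym_iff {φ : P1Q → P1Q → V} : φ ∈ modSym R V ↔ ∀ x y z : P1Q, φ x y + φ y z = φ x z := Iff.rfl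

/-- `φ(x, x) = 0`. [folklore] -/
theorem modSym_self {φ : P1Q → P1Q → V} (hφ : φ ∈ modSym R V) (x : P1Q) : φ x x = 0 := by
  have h := hφ x x x
  exact add_left_cancel (h.trans (add_zero _).symm)

/-- `φ(y, x) = −φ(x, y)`. [folklore] -/
theorem modSym_swap {φ : P1Q → P1Q → V} (hφ : φ ∈ modSym R V) (x y : P1Q) : φ y x = -φ x y := by
  have h := hφ x y x
  rw [modSym_self hφ] at h
  exact eq_neg_of_add_eq_zero_right h

end ModSym

/-! ### Coefficient systems on a set of matrices and the slash action -/

/-- A **coefficient system on a set `S` of integer matrices**: an `R`-module `V` with `R`-linear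
operators `ρ(M)`, a right action on `S` (`ρ(MM') = ρ(M') ∘ ρ(M)` for `M, M' ∈ S`, `ρ(1) = id`).
Examples: `Symⁿ` with `S` = all matrices; the weight-`k` distributions on `ℤ_p` with `S = Σ₀(p)`.
[folklore] -/
structure CoeffActionOn (S : Set (Matrix (Fin 2) (Fin 2) ℤ)) (R V : Type*) [CommRing R] [AddCommGroup V]
    [Module R V] where
  /-- the operator of a matrix -/
  ρ : Matrix (Fin 2) (Fin 2) ℤ → (V →ₗ[R] V)
  /-- right action on `S` -/
  ρ_mul : ∀ M ∈ S, ∀ M' ∈ S, ρ (M * M') = (ρ M').comp (ρ M)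
  /-- the identity acts trivially -/
  ρ_one : ρ 1 = LinearMap.id

namespace CoeffActionOn

variable {S : Set (Matrix (Fin 2) (Fin 2) ℤ)} {R V W : Type*} [CommRing R] [AddCommGroup V] [Module R V]
  [AddCommGroup W] [Module R W] (A : CoeffActionOn S R V) (B : CoeffActionOn S R W)

/-- **The slash action on functions of pairs of cusps**: `(φ | g)(x, y) = ρ(g)(φ(g x, g y))`
(`(Φ|g)(D) = Φ(gD)|g`, Bellaïche 2011, §3.2.1). [cite: Bellaiche2011, §3.2.1] -/
def slash (g : Matrix (Fin 2) (Fin 2) ℤ) : (P1Q → P1Q → V) →ₗ[R] (P1Q → P1Q → V) where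
  toFun φ x y := A.ρ g (φ (P1Q.act g x) (P1Q.act g y))
  map_add' φ ψ := by funext x y; simp
  map_smul' c φ := by funext x y; simp

/-- Unfolding `slash`. [folklore] -/
@[simp] theorem slash_apply (g : Matrix (Fin 2) (Fin 2) ℤ) (φ : P1Q → P1Q → V) (x y : P1Q) :
    A.slash g φ x y = A.ρ g (φ (P1Q.act g x) (P1Q.act g y)) := rfl

/-- The slash action preserves additivity. [folklore] -/
theorem slash_mem_modSym (g : Matrix (Fin 2) (Fin 2) ℤ) {φ : P1Q → P1Q → V} (hφ : φ ∈ modSym R V) :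
    A.slash g φ ∈ modSym R V := by
  intro x y z
  rw [slash_apply, slash_apply, slash_apply, ← map_add, hφ]

/-- **The slash action is a right action** on `S` (non-zero determinants):
`φ | (g g') = (φ | g) | g'`. [folklore] -/
theorem slash_mul {g g' : Matrix (Fin 2) (Fin 2) ℤ} (hg : g ∈ S) (hg' : g' ∈ S) (hdg : g.det ≠ 0)
    (hdg' : g'.det ≠ 0) : A.slash (g * g') = (A.slash g').comp (A.slash g) := by
  refine LinearMap.ext fun φ => funext fun x => funext fun y => ?_
  rw [LinearMap.comp_apply, slash_apply, slash_apply, slash_apply, A.ρ_mul g hg g' hg',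
    LinearMap.comp_apply, P1Q.act_act hdg hdg', P1Q.act_act hdg hdg']

/-- The identity slashes trivially. [folklore] -/
theorem slash_one : A.slash 1 = LinearMap.id := by
  refine LinearMap.ext fun φ => funext fun x => funext fun y => ?_
  rw [slash_apply, A.ρ_one, P1Q.act_one]
  rfl

/-! ### `Γ`-invariant symbols and the Hecke operators -/

/-- **The modular symbols `Symb_Γ(V) = Hom_Γ(Δ₀, V)`**: additive functions on pairs of cusps
invariant under the slash action of `Γ ≤ SL(2, ℤ)`. [cite: Bellaiche2011, §3.2.1] -/
def Symb (Γ : Subgroup SL(2, ℤ)) : Submodule R (P1Q → P1Q → V) where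
  carrier := {φ | φ ∈ modSym R V ∧ ∀ γ : SL(2, ℤ), γ ∈ Γ → A.slash (γ : Matrix (Fin 2) (Fin 2) ℤ) φ = φ}
  add_mem' := by
    rintro φ ψ ⟨hφ, hφ'⟩ ⟨hψ, hψ'⟩
    exact ⟨add_mem hφ hψ, fun γ hγ => by rw [map_add, hφ' γ hγ, hψ' γ hγ]⟩
  zero_mem' := ⟨zero_mem _, fun γ _ => by rw [map_zero]⟩
  smul_mem' := by
    rintro c φ ⟨hφ, hφ'⟩
    exact ⟨Submodule.smul_mem _ c hφ, fun γ hγ => by rw [map_smul, hφ' γ hγ]⟩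

/-- Membership in `Symb`. [folklore] -/
theorem mem_Symb_iff {Γ : Subgroup SL(2, ℤ)} {φ : P1Q → P1Q → V} :
    φ ∈ A.Symb Γ ↔ φ ∈ modSym R V ∧ ∀ γ : SL(2, ℤ), γ ∈ Γ → A.slash (γ : Matrix (Fin 2) (Fin 2) ℤ) φ = φ :=
  Iff.rfl

section Hecke

variable {N : ℕ} {p : ℕ} [NeZero p]

variable (N p) in
/-- **The Hecke operator `[Γ₀(N) diag(1,p) Γ₀(N)] = Σᵢ (· | βᵢ)`** on functions of pairs of cusps,
with the representatives `βᵢ = heckeRep p i` (`T_p` for `p ∤ N`, `U_p` for `p ∣ N`).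
[cite: Shimura1971, §3.4] -/
def hecke : (P1Q → P1Q → V) →ₗ[R] (P1Q → P1Q → V) := ∑ i : HeckeIdx N p, A.slash (heckeRep p i.1)

/-- Unfolding `hecke`. [folklore] -/
theorem hecke_apply (φ : P1Q → P1Q → V) : A.hecke N p φ = ∑ i : HeckeIdx N p, A.slash (heckeRep p i.1) φ := by
  rw [hecke, LinearMap.sum_apply]

/-- The Hecke operator preserves additivity. [folklore] -/
theorem hecke_mem_modSym {φ : P1Q → P1Q → V} (hφ : φ ∈ modSym R V) : A.hecke N p φ ∈ modSym R V := by
  rw [hecke_apply]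
  exact Submodule.sum_mem _ fun i _ => A.slash_mem_modSym _ hφ

/-- **The Hecke operator preserves `Symb_{Γ₀(N)}(V)`** when `Γ₀(N) ⊆ S` and the representatives
`βᵢ ∈ S` (Shimura: `βᵢ γ = γ'ᵢ β_{σ(i)}` with `γ'ᵢ ∈ Γ₀(N)` and
`σ` a permutation). [cite: Shimura1971, §3.4, §8.3] -/
theorem hecke_mem_Symb (hp : p.Prime) (hΓ : ∀ γ : Gamma0 N, gmat γ ∈ S) (hβ : ∀ i : HeckeIdx N p, heckeRep p i.1 ∈ S)
    {φ : P1Q → P1Q → V} (hφ : φ ∈ A.Symb (Gamma0 N)) : A.hecke N p φ ∈ A.Symb (Gamma0 N) := by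
  refine ⟨A.hecke_mem_modSym hφ.1, fun γ hγ => ?_⟩
  set γ₀ : Gamma0 N := ⟨γ, hγ⟩ with hγ₀
  have hγmat : (γ : Matrix (Fin 2) (Fin 2) ℤ) = gmat γ₀ := rfl
  have hdetβ : ∀ i : HeckeIdx N p, (heckeRep p i.1).det ≠ 0 := fun i => by
    rw [det_heckeRep]; exact_mod_cast hp.ne_zero
  have hdetγ : ∀ δ : Gamma0 N, (gmat δ).det ≠ 0 := fun δ => by
    rw [gmat, Matrix.SpecialLinearGroup.det_coe]; exact one_ne_zero
  rw [hecke_apply, map_sum, hγmat]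
  -- `(φ|βᵢ)|γ = φ|(βᵢγ) = φ|(γ'ᵢ β_{σ i}) = (φ|γ'ᵢ)|β_{σ i} = φ|β_{σ i}`
  have hterm : ∀ i : HeckeIdx N p, A.slash (gmat γ₀) (A.slash (heckeRep p i.1) φ) =
      A.slash (heckeRep p (heckePerm hp γ₀ i).1) φ := by
    intro i
    have e := gmat_heckePermElt_mul hp γ₀ i
    rw [← LinearMap.comp_apply (f := A.slash (gmat γ₀)), ← A.slash_mul (hβ i) (hΓ γ₀) (hdetβ i) (hdetγ γ₀), ← e,
      A.slash_mul (hΓ _) (hβ _) (hdetγ _) (hdetβ _), LinearMap.comp_apply]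
    congr 1
    exact hφ.2 _ (heckePermElt hp γ₀ i).2
  rw [Finset.sum_congr rfl fun i _ => hterm i]
  exact Finset.sum_equiv (heckePermEquiv hp γ₀) (fun i => by simp) (fun i _ => by rw [heckePermEquiv_apply])

variable (N p) in
/-- **The Hecke operator on `Symb_{Γ₀(N)}(V)`.** [cite: Shimura1971, §3.4] -/
def heckeSymb (hp : p.Prime) (hΓ : ∀ γ : Gamma0 N, gmat γ ∈ S)
    (hβ : ∀ i : HeckeIdx N p, heckeRep p i.1 ∈ S) : Module.End R (A.Symb (Gamma0 N)) :=
  (A.hecke N p).restrict fun _ hφ => A.hecke_mem_Symb hp hΓ hβ hφ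

/-- Unfolding `heckeSymb`. [folklore] -/
@[simp] theorem coe_heckeSymb (hp : p.Prime) (hΓ : ∀ γ : Gamma0 N, gmat γ ∈ S)
    (hβ : ∀ i : HeckeIdx N p, heckeRep p i.1 ∈ S) (φ : A.Symb (Gamma0 N)) :
    ((A.heckeSymb N p hp hΓ hβ φ : A.Symb (Gamma0 N)) : P1Q → P1Q → V) = A.hecke N p φ := rfl

end Hecke

/-! ### Morphisms of coefficient systems and the induced maps on symbols -/

/-- A **morphism of coefficient systems on `S`**: an `R`-linear map intertwining `ρ(M)` for `M ∈ S`.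
[folklore] -/
structure Hom where
  /-- the underlying linear map -/
  toLinearMap : V →ₗ[R] W
  /-- equivariance on `S` -/
  comm : ∀ M ∈ S, ∀ v : V, toLinearMap (A.ρ M v) = B.ρ M (toLinearMap v)

namespace Hom

variable {A B} (T : Hom A B)

/-- Post-composition with a morphism on functions of pairs of cusps. [folklore] -/
def mapFun : (P1Q → P1Q → V) →ₗ[R] (P1Q → P1Q → W) where
  toFun φ x y := T.toLinearMap (φ x y)
  map_add' φ ψ := by funext x y; simp
  map_smul' c φ := by funext x y; simp

/-- Unfolding `mapFun`. [folklore] -/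
@[simp] theorem mapFun_apply (φ : P1Q → P1Q → V) (x y : P1Q) : T.mapFun φ x y = T.toLinearMap (φ x y) := rfl

/-- `mapFun` commutes with the slash action of `g ∈ S`. [folklore] -/
theorem mapFun_slash {g : Matrix (Fin 2) (Fin 2) ℤ} (hg : g ∈ S) (φ : P1Q → P1Q → V) :
    T.mapFun (A.slash g φ) = B.slash g (T.mapFun φ) := by
  funext x y
  rw [mapFun_apply, slash_apply, slash_apply, T.comm g hg, mapFun_apply]

/-- `mapFun` preserves additivity. [folklore] -/
theorem mapFun_mem_modSym {φ : P1Q → P1Q → V} (hφ : φ ∈ modSym R V) : T.mapFun φ ∈ modSym R W := by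
  intro x y z
  rw [mapFun_apply, mapFun_apply, mapFun_apply, ← map_add, hφ]

/-- **A morphism of coefficient systems maps `Symb_Γ(V)` to `Symb_Γ(W)`** (when `Γ ⊆ S`). [folklore] -/
theorem mapFun_mem_Symb {Γ : Subgroup SL(2, ℤ)} (hΓ : ∀ γ : SL(2, ℤ), γ ∈ Γ → (γ : Matrix (Fin 2) (Fin 2) ℤ) ∈ S)
    {φ : P1Q → P1Q → V} (hφ : φ ∈ A.Symb Γ) : T.mapFun φ ∈ B.Symb Γ :=
  ⟨T.mapFun_mem_modSym hφ.1, fun γ hγ => by rw [← T.mapFun_slash (hΓ γ hγ), hφ.2 γ hγ]⟩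

/-- **A morphism of coefficient systems commutes with the Hecke operators** (representatives in `S`).
[folklore] -/
theorem mapFun_hecke {N p : ℕ} [NeZero p] (hβ : ∀ i : HeckeIdx N p, heckeRep p i.1 ∈ S)
    (φ : P1Q → P1Q → V) : T.mapFun (A.hecke N p φ) = B.hecke N p (T.mapFun φ) := by
  rw [hecke_apply, hecke_apply, map_sum]
  exact Finset.sum_congr rfl fun i _ => T.mapFun_slash (hβ i) φ

end Hom

/-! ### The coefficient system of a total action -/

/-- A coefficient system on all matrices (`HidaOrdinaryCohomologyCocycles`-style right action, e.g.
`Symⁿ`) is a coefficient system on any `S`. [folklore] -/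
def ofTotal (S : Set (Matrix (Fin 2) (Fin 2) ℤ)) {R V : Type*} [CommRing R] [AddCommGroup V] [Module R V]
    (ρ : Matrix (Fin 2) (Fin 2) ℤ → (V →ₗ[R] V))
    (hmul : ∀ M M', ρ (M * M') = (ρ M').comp (ρ M)) (hone : ρ 1 = LinearMap.id) : CoeffActionOn S R V where
  ρ := ρ
  ρ_mul M _ M' _ := hmul M M'
  ρ_one := hone

/-- **The coefficient system `Symⁿ`** (`act n`) on any set of matrices. [folklore] -/
def symPowOn (S : Set (Matrix (Fin 2) (Fin 2) ℤ)) (n : ℕ) (R : Type*) [CommRing R] :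
    CoeffActionOn S R (Fin (n + 1) → R) :=
  ofTotal S (act n) act_mul act_one

end CoeffActionOn

end Literature.NumberTheory.EllipticCurves

end
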